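import Literature.Geometry.Symplectic.OrigamiNullFoliation
import Literature.Geometry.Symplectic.SymplecticOrientation
import HarnessLib

/-!
# Near-positive and near-symplectic forms on an oriented `4`-manifold (Perutz 2006, Def. 1.1)

Topic `Literature/Geometry/Symplectic` (vocabulary of the printed proof behind the named fact
`Literature.Geometry.Symplectic.relNearSymplecticTaubesTubes_exists`; definitions + proved API,
no named facts).

Perutz 2006, Def. 1.1 (following Auroux–Donaldson–Katzarkov): a `2`-form `ω` on an ORIENTED
`4`-manifold `X` is **near-positive** if at each point `x` either (i) `(ω ∧ ω)(x) > 0`, or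
(ii) `ω(x) = 0` and the intrinsic gradient `(∇ω)(x) : T_x X → Λ² T*_x X` has rank `3`; it is
**near-symplectic** if moreover `dω = 0`.  Its zero set `Z_ω = {ω = 0}` is then a `1`-dimensional
submanifold (Lemma 1.2), and `ω` is symplectic on `X ∖ Z_ω`.

## The tree's rendering

Forms are the tree's `MForm (𝓡 4) M ℝ 2` (`Literature.Geometry.Kaehler.ManifoldForms`), whose
value `ω x` at `x` is an alternating map on `TangentSpace (𝓡 4) x = ℝ⁴` read in the preferred
chart at `x`; orientations are the tree's `Literature.Topology.FourManifolds.SmoothOrientation`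
(`o x` = an orientation of `ℝ⁴`, the tangent space read in the same preferred chart).  Hence:

* (i) is `IsWedgeSqPos o ω x`: the chart Pfaffian `Pf(ω x)` (`pfaffian`, `OrigamiForm.lean`:
  `ω ∧ ω = 2 Pf(ω) e⁰¹²³`) is non-zero and `sign Pf(ω x) · [e₀, e₁, e₂, e₃] = o x`
  (`signOrientationIn`, `SymplecticOrientation.lean`) — i.e. `ω ∧ ω` is positive on `o`-oriented
  frames; equivalently, `o x` is the symplectic orientation of `ω` at `x`
  (`symplecticSmoothOrientation_apply`).
* (ii) is `IsTransverseZero ω x`: `ω x = 0` and the derivative at `e x` of the chart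
  representative `ω.inChart x` (`zeroGradient ω x : ℝ⁴ →L (Λ²)`, which at a ZERO of `ω` is the
  intrinsic gradient read in the chart) has rank `3`.
* `IsNearPositive o ω`, `IsNearSymplectic o ω` (adds `IsSmoothForm`, `IsClosedForm`),
  `zeroLocus ω`.

Proved API: positivity points are non-degenerate and not zeros (`pfaffian_eq_zero_iff`), so for a
near-positive form the degeneracy locus (`fold`) is exactly the zero locus and `ω` is symplectic
off `Z_ω` ("near-symplectic forms are symplectic away from their zero circles"); a symplectic form
is near-positive for its own symplectic orientation (`Z = ∅`).

## Not here

Lemma 1.2 (`Z_ω` is a `1`-submanifold), the definiteness of `im ∇ω` (Perutz's remark after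
Def. 1.1), the parity of zero circles (Prop. 2.2) and the local models (§2; the untwisted model
`ω_A` is `hondaFormA` of `HondaUntwistedModel.lean`) are not formalized in this file.

## References

* T. Perutz, *Zero-sets of near-symplectic forms*, J. Symplectic Geom. 4 (2006), Def. 1.1,
  Lemma 1.2 [Perutz2006].
* D. McDuff, D. Salamon, *Introduction to Symplectic Topology*, 3rd ed. (2017), §2.1 Cor. 2.1.4
  (`ω` nondegenerate iff `ω ∧ ω ≠ 0`, the symplectic orientation) [McDuffSalamon2017].
-/

noncomputable section

open scoped Manifold ContDiff Topology
open Set Function Literature.Geometry.Kaehler Literature.Topology.FourManifolds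

namespace Literature.Geometry.Symplectic

/-- Local notation: `𝔼 n` is the model space `EuclideanSpace ℝ (Fin n)`. -/
local notation "𝔼" n:arg => EuclideanSpace ℝ (Fin n)

universe u

/-! ### The zero locus and the intrinsic gradient at a zero -/

section Zero

variable {M : Type u} [TopologicalSpace M] [ChartedSpace (𝔼 4) M]

/-- **The zero locus** `Z_ω = {x | ω(x) = 0}` of a `2`-form (Perutz 2006, Lemma 1.2: `Z_ω`).
[cite: Perutz2006, Def. 1.1 and Lemma 1.2] -/
def zeroLocus (α : MForm (𝓡 4) M ℝ 2) : Set M :=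
  {x | α x = 0}

/-- Membership in the zero locus. [folklore] -/
@[simp] theorem mem_zeroLocus {α : MForm (𝓡 4) M ℝ 2} {x : M} : x ∈ zeroLocus α ↔ α x = 0 :=
  Iff.rfl

/-- The zero locus lies in the degeneracy locus (`fold`). [folklore] -/
theorem zeroLocus_subset_fold (α : MForm (𝓡 4) M ℝ 2) : zeroLocus α ⊆ fold α := by
  intro x hx
  rw [mem_zeroLocus] at hx
  have hne : (EuclideanSpace.single (0 : Fin 4) (1 : ℝ) : 𝔼 4) ≠ 0 := by simp
  exact (mem_fold_iff α x).2 ⟨EuclideanSpace.single 0 1, hne, fun w => by simp [hx]⟩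

/-- **The gradient of `ω` at `x` read in the preferred chart**: the Fréchet derivative at `e x`
of the chart representative `ω.inChart x : ℝ⁴ → Λ²(ℝ⁴)*` (`e = extChartAt (𝓡 4) x`).  At a ZERO
of `ω` this is the intrinsic gradient `(∇ω)(x) : T_x X → Λ² T*_x X` of Perutz 2006, Def. 1.1
("because `x` is a zero of a smooth section of a vector bundle"), in the chart's trivialisation;
at other points it is chart-dependent and not used. [cite: Perutz2006, Def. 1.1] -/
def zeroGradient (α : MForm (𝓡 4) M ℝ 2) (x : M) : (𝔼 4) →L[ℝ] ((𝔼 4) [⋀^Fin 2]→L[ℝ] ℝ) :=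
  fderiv ℝ (α.inChart x) (extChartAt (𝓡 4) x x)

/-- **Transverse zero** (clause (ii) of Perutz 2006, Def. 1.1): `ω(x) = 0` and the intrinsic
gradient `(∇ω)(x)` has rank `3` as a linear map. [cite: Perutz2006, Def. 1.1] -/
def IsTransverseZero (α : MForm (𝓡 4) M ℝ 2) (x : M) : Prop :=
  α x = 0 ∧ Module.finrank ℝ (LinearMap.range (zeroGradient α x).toLinearMap) = 3

/-- A transverse zero is a zero. [folklore] -/
theorem IsTransverseZero.mem_zeroLocus {α : MForm (𝓡 4) M ℝ 2} {x : M}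
    (h : IsTransverseZero α x) : x ∈ zeroLocus α :=
  h.1

/-- At a transverse zero the gradient has rank `3`. [folklore] -/
theorem IsTransverseZero.finrank_range_eq {α : MForm (𝓡 4) M ℝ 2} {x : M}
    (h : IsTransverseZero α x) :
    Module.finrank ℝ (LinearMap.range (zeroGradient α x).toLinearMap) = 3 :=
  h.2

/-- At a transverse zero the gradient has a `1`-dimensional kernel (the tangent line of the zero
set, Perutz 2006, proof of Lemma 1.2: `T_x Z = ker (∇ω)(x)`; rank–nullity in `ℝ⁴`).
[cite: Perutz2006, Lemma 1.2] -/
theorem IsTransverseZero.finrank_ker_eq {α : MForm (𝓡 4) M ℝ 2} {x : M}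
    (h : IsTransverseZero α x) :
    Module.finrank ℝ (LinearMap.ker (zeroGradient α x).toLinearMap) = 1 := by
  have hrn := LinearMap.finrank_range_add_finrank_ker (zeroGradient α x).toLinearMap
  rw [h.2, finrank_euclideanSpace_fin] at hrn
  omega

/-- A non-degenerate `2`-form has empty zero locus. [folklore] -/
theorem zeroLocus_eq_empty_of_nondegenerate {α : MForm (𝓡 4) M ℝ 2}
    (hnd : ∀ x (v : TangentSpace (𝓡 4) x), v ≠ 0 → ∃ w : TangentSpace (𝓡 4) x, α x ![v, w] ≠ 0) :
    zeroLocus α = ∅ := by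
  ext x
  simp only [mem_zeroLocus, mem_empty_iff_false, iff_false]
  intro hx
  have hne : (EuclideanSpace.single (0 : Fin 4) (1 : ℝ) : 𝔼 4) ≠ 0 := by simp
  obtain ⟨w, hw⟩ := hnd x (EuclideanSpace.single 0 1) hne
  exact hw (by simp [hx])

end Zero

/-! ### Positivity of `ω ∧ ω` with respect to an orientation -/

section Oriented

variable {M : Type u} [TopologicalSpace M] [ChartedSpace (𝔼 4) M] [IsManifold (𝓡 4) ∞ M]

/-- **`(ω ∧ ω)(x) > 0`** for the orientation `o` (clause (i) of Perutz 2006, Def. 1.1): the chart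
Pfaffian of `ω x` (`ω ∧ ω = 2 Pf(ω) e⁰ ∧ e¹ ∧ e² ∧ e³` in the preferred chart at `x`) is non-zero
and `sign Pf(ω x) · [e₀, e₁, e₂, e₃]` is the given orientation `o x` of `T_x M` (read in the same
chart); i.e. `ω ∧ ω` is positive on `o`-positive frames.  Equivalently `o x` is the symplectic
orientation of `ω` at `x` (McDuff–Salamon 2017, §2.1; `symplecticSmoothOrientation_apply`).
[cite: Perutz2006, Def. 1.1] -/
def IsWedgeSqPos (o : SmoothOrientation (𝓡 4) M) (α : MForm (𝓡 4) M ℝ 2) (x : M) : Prop :=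
  pfaffian (α x) ≠ 0 ∧ o x = signOrientationIn 4 (pfaffian (α x))

/-- **Near-positive forms** (Perutz 2006, Def. 1.1): at each point either `ω ∧ ω > 0` (for the
orientation `o`) or `ω` has a transverse zero. [cite: Perutz2006, Def. 1.1] -/
def IsNearPositive (o : SmoothOrientation (𝓡 4) M) (α : MForm (𝓡 4) M ℝ 2) : Prop :=
  ∀ x : M, IsWedgeSqPos o α x ∨ IsTransverseZero α x

/-- **Near-symplectic forms** (Perutz 2006, Def. 1.1): smooth, closed and near-positive.
[cite: Perutz2006, Def. 1.1] -/
def IsNearSymplectic (o : SmoothOrientation (𝓡 4) M) (α : MForm (𝓡 4) M ℝ 2) : Prop :=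
  IsSmoothForm α ∧ IsClosedForm α ∧ IsNearPositive o α

variable {o : SmoothOrientation (𝓡 4) M} {α : MForm (𝓡 4) M ℝ 2} {x : M}

/-- Where `ω ∧ ω > 0`, the Pfaffian is non-zero. [folklore] -/
theorem IsWedgeSqPos.pfaffian_ne_zero (h : IsWedgeSqPos o α x) : pfaffian (α x) ≠ 0 :=
  h.1

/-- Where `ω ∧ ω > 0`, the orientation is the symplectic one. [folklore] -/
theorem IsWedgeSqPos.eq_signOrientationIn (h : IsWedgeSqPos o α x) :
    o x = signOrientationIn 4 (pfaffian (α x)) :=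
  h.2

/-- Where `ω ∧ ω > 0`, `ω` is non-degenerate (McDuff–Salamon 2017, Cor. 2.1.4; the tree's
`pfaffian_eq_zero_iff`). [cite: McDuffSalamon2017, §2.1 Cor. 2.1.4] -/
theorem IsWedgeSqPos.nondegenerate (h : IsWedgeSqPos o α x) (v : TangentSpace (𝓡 4) x)
    (hv : v ≠ 0) : ∃ w : TangentSpace (𝓡 4) x, α x ![v, w] ≠ 0 := by
  by_contra hw
  push Not at hw
  exact h.1 ((pfaffian_eq_zero_iff (α x)).2 ⟨v, hv, hw⟩)

/-- Where `ω ∧ ω > 0`, `x` is off the degeneracy locus. [folklore] -/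
theorem IsWedgeSqPos.not_mem_fold (h : IsWedgeSqPos o α x) : x ∉ fold α := by
  rw [mem_fold_iff_pfaffian_eq_zero]
  exact h.1

/-- Where `ω ∧ ω > 0`, `ω(x) ≠ 0`. [folklore] -/
theorem IsWedgeSqPos.not_mem_zeroLocus (h : IsWedgeSqPos o α x) : x ∉ zeroLocus α :=
  fun hx => h.not_mem_fold (zeroLocus_subset_fold α hx)

/-- The two clauses of Def. 1.1 are exclusive. [folklore] -/
theorem IsWedgeSqPos.not_isTransverseZero (h : IsWedgeSqPos o α x) : ¬ IsTransverseZero α x :=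
  fun h' => h.not_mem_zeroLocus h'.mem_zeroLocus

/-- Reversing the orientation destroys positivity of `ω ∧ ω`. [folklore] -/
theorem IsWedgeSqPos.not_neg (h : IsWedgeSqPos o α x) : ¬ IsWedgeSqPos (-o) α x := by
  rintro ⟨-, h'⟩
  rw [SmoothOrientation.neg_apply, h.2] at h'
  exact Module.Ray.ne_neg_self _ h'.symm

/-- `-ω` has the same Pfaffian as `ω` (`Pf` is even, `pfaffian_neg`), so `ω ∧ ω > 0` iff
`(-ω) ∧ (-ω) > 0` for the SAME orientation: the sign of a near-symplectic form is invisible to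
clause (i) (cf. Honda 2004, Thm. 5: normal forms "up to `±ω`"). [folklore] -/
theorem isWedgeSqPos_neg_iff : IsWedgeSqPos o (-α) x ↔ IsWedgeSqPos o α x := by
  have h : pfaffian ((-α) x) = pfaffian (α x) := pfaffian_neg (α x)
  simp only [IsWedgeSqPos, h]

namespace IsNearPositive

/-- **Off its zero locus a near-positive form has `ω ∧ ω > 0`.** [cite: Perutz2006, Def. 1.1] -/
theorem isWedgeSqPos_of_not_mem (h : IsNearPositive o α) (hx : x ∉ zeroLocus α) :
    IsWedgeSqPos o α x :=
  (h x).resolve_right fun h' => hx h'.mem_zeroLocus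

/-- **A near-positive form is non-degenerate off its zero locus** (Perutz 2006, §1: `ω` is
symplectic on `X ∖ Z_ω`). [cite: Perutz2006, Def. 1.1] -/
theorem nondegenerate_of_not_mem (h : IsNearPositive o α) (hx : x ∉ zeroLocus α)
    (v : TangentSpace (𝓡 4) x) (hv : v ≠ 0) : ∃ w : TangentSpace (𝓡 4) x, α x ![v, w] ≠ 0 :=
  (h.isWedgeSqPos_of_not_mem hx).nondegenerate v hv

/-- Every zero of a near-positive form is a transverse zero. [cite: Perutz2006, Def. 1.1] -/
theorem isTransverseZero_of_mem (h : IsNearPositive o α) (hx : x ∈ zeroLocus α) :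
    IsTransverseZero α x :=
  (h x).resolve_left fun h' => h'.not_mem_zeroLocus hx

/-- **For a near-positive form the degeneracy locus is the zero locus.** [cite: Perutz2006, Def. 1.1] -/
theorem fold_eq_zeroLocus (h : IsNearPositive o α) : fold α = zeroLocus α := by
  refine Subset.antisymm (fun x hx => ?_) (zeroLocus_subset_fold α)
  by_contra hz
  exact (h.isWedgeSqPos_of_not_mem hz).not_mem_fold hx

/-- Off the zero locus the given orientation is the symplectic orientation of `ω`
(`sign Pf(ω x) · [e₀, …, e₃]`). [folklore] -/
theorem eq_signOrientationIn_of_not_mem (h : IsNearPositive o α) (hx : x ∉ zeroLocus α) :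
    o x = signOrientationIn 4 (pfaffian (α x)) :=
  (h.isWedgeSqPos_of_not_mem hx).2

end IsNearPositive

namespace IsNearSymplectic

/-- A near-symplectic form is smooth. [folklore] -/
theorem isSmoothForm (h : IsNearSymplectic o α) : IsSmoothForm α := h.1

/-- A near-symplectic form is closed. [folklore] -/
theorem isClosedForm (h : IsNearSymplectic o α) : IsClosedForm α := h.2.1

/-- A near-symplectic form is near-positive. [folklore] -/
theorem isNearPositive (h : IsNearSymplectic o α) : IsNearPositive o α := h.2.2

/-- **A near-symplectic form is symplectic off its zero locus** (Perutz 2006, §1).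
[cite: Perutz2006, Def. 1.1] -/
theorem nondegenerate_of_not_mem (h : IsNearSymplectic o α) (hx : x ∉ zeroLocus α)
    (v : TangentSpace (𝓡 4) x) (hv : v ≠ 0) : ∃ w : TangentSpace (𝓡 4) x, α x ![v, w] ≠ 0 :=
  h.isNearPositive.nondegenerate_of_not_mem hx v hv

/-- The degeneracy locus of a near-symplectic form is its zero locus. [folklore] -/
theorem fold_eq_zeroLocus (h : IsNearSymplectic o α) : fold α = zeroLocus α :=
  h.isNearPositive.fold_eq_zeroLocus

end IsNearSymplectic

/-! ### Symplectic forms are near-symplectic without zeros -/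

/-- **A non-degenerate `2`-form is near-positive for its symplectic orientation**, with empty
zero locus (the case `Z_ω = ∅` of Perutz 2006, Def. 1.1; McDuff–Salamon 2017, §2.1).
[cite: Perutz2006, Def. 1.1] -/
theorem isNearPositive_symplecticSmoothOrientation (hs : IsSmoothForm α)
    (hnd : ∀ x (v : TangentSpace (𝓡 4) x), v ≠ 0 → ∃ w : TangentSpace (𝓡 4) x, α x ![v, w] ≠ 0) :
    IsNearPositive (symplecticSmoothOrientation α hs hnd) α := fun x =>
  Or.inl ⟨pfaffian_ne_zero_of_nondegenerate _ (hnd x), symplecticSmoothOrientation_apply α hs hnd x⟩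

/-- **A smooth closed non-degenerate `2`-form is near-symplectic for its symplectic
orientation.** [cite: Perutz2006, Def. 1.1] -/
theorem isNearSymplectic_symplecticSmoothOrientation (hs : IsSmoothForm α) (hc : IsClosedForm α)
    (hnd : ∀ x (v : TangentSpace (𝓡 4) x), v ≠ 0 → ∃ w : TangentSpace (𝓡 4) x, α x ![v, w] ≠ 0) :
    IsNearSymplectic (symplecticSmoothOrientation α hs hnd) α :=
  ⟨hs, hc, isNearPositive_symplecticSmoothOrientation hs hnd⟩

/-- For a near-positive form, **the orientation is determined off the zero locus**: two
orientations making the same form near-positive agree off `Z_ω`. [folklore] -/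
theorem IsNearPositive.eq_of_not_mem {o o' : SmoothOrientation (𝓡 4) M} (h : IsNearPositive o α)
    (h' : IsNearPositive o' α) (hx : x ∉ zeroLocus α) : o x = o' x := by
  rw [h.eq_signOrientationIn_of_not_mem hx, h'.eq_signOrientationIn_of_not_mem hx]

end Oriented

end Literature.Geometry.Symplectic

end
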